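import Literature.Geometry.Kaehler.ComplexTorusAverage
import Literature.Geometry.Kaehler.TranslationHomotopy
import Literature.Analysis.FunctionSpaces.SmoothParametricSetIntegral
import HarnessLib

/-!
# The de Rham cohomology of a complex torus is the exterior algebra of invariant forms

Companion of `Literature/Geometry/Kaehler/ComplexTorusAverage.lean` (averaging, `avgClass`,
injectivity of `constClass`) and `TranslationHomotopy.lean` (the homotopy operator `P_a` of a
translation). We prove the surjectivity half and assemble **Lange–Birkenhake (1992),
Prop. 1.1.20**: for the complex torus `X = E/Φ(ℤ^ι)` and a complete real normed coefficient space
`F`,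

* `ComplexTorus.mk_eq_constClass_avg`: every closed smooth `k`-form `α` on `X` is cohomologous to
  the invariant form with value its average, `[α] = [constForm (∫ₓ α)]`;
* `ComplexTorus.constClassEquiv Φ : Alt^k(E; F) ≃ₗ[ℝ] H^k_dR(X; F)`, `c ↦ [constForm Φ c]`, with
  inverse `avgClass` ("the de Rham isomorphism induces an isomorphism `H^n_dR(X) ≅ IF^n(X)`":
  every de Rham class has a unique invariant representative).

## Proof (surjectivity)

Lift `α` to the `Φ(ℤ^ι)`-periodic closed form `θ = π^* α` on `E` (`ComplexTorusCover`). For each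
translation vector `a`, `θ(· + a) - θ = d (P_a θ)` (`sub_eq_extDeriv_transOperator`). Average
over `a = Φ u`, `u` in the unit box `(0, 1]^ι` (a fundamental domain, mapped measure-preservingly
onto `X` by `proj`): `∫ θ(x + Φ u) du = ∫ₓ α` is the constant average (Haar invariance,
`integral_val_add_cover`), while `∫ d(P_{Φu} θ)(x) du = d(∫ P_{Φu} θ du)(x)` (differentiation
under the integral sign over the bounded box,
`Literature.Analysis.FunctionSpaces.hasFDerivAt_parametric_setIntegral`). So
`θ = avg - dη` with `η = ∫ P_{Φu} θ du` smooth (`contDiff_parametric_setIntegral`) and periodic,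
hence `α = constForm (avg α) - d(descend η)` on `X`. In degree `0` a closed form is constant.
This is the standard averaging proof (e.g. Griffiths–Harris (1978), pp. 301–302), replacing
Lange–Birkenhake's appeal to the Künneth/duality computation of `H^*(X, ℂ)`.

## References

* H. Lange, Ch. Birkenhake, *Complex Abelian Varieties*, Grundlehren 302 (1992), §1.1.4,
  Prop. 1.1.20. [LangeBirkenhake1992]
* R. Bott, L. W. Tu, *Differential Forms in Algebraic Topology* (1982), §I.4 (homotopy
  operators). [BottTu1982Forms]
-/

noncomputable section

open scoped Manifold ContDiff Topology
open Bundle Set Filter MeasureTheory MeasureTheory.Measure ContinuousAlternatingMap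

namespace Literature.Geometry.Kaehler

namespace ComplexTorus

variable {ι : Type*} [Fintype ι] {E : Type*} [NormedAddCommGroup E] [NormedSpace ℂ E]
  (Φ : (ι → ℝ) ≃L[ℝ] E)

/-! ### The unit box, a fundamental domain -/

/-- The unit box `(0, 1]^ι ⊆ ℝ^ι`, a fundamental domain for `ℤ^ι` (and, through `Φ`, for the
lattice `Φ(ℤ^ι) ⊆ E`). [folklore] -/
def box : Set (ι → ℝ) := Set.pi univ fun _ ↦ Ioc (0 : ℝ) 1

/-- The unit box is measurable. [folklore] -/
theorem measurableSet_box : MeasurableSet (box : Set (ι → ℝ)) :=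
  MeasurableSet.univ_pi fun _ ↦ measurableSet_Ioc

/-- The unit box is bounded. [folklore] -/
theorem isBounded_box : Bornology.IsBounded (box : Set (ι → ℝ)) :=
  (Metric.isBounded_Icc (0 : ι → ℝ) 1).subset fun _ hu ↦
    ⟨fun i ↦ (hu i (mem_univ i)).1.le, fun i ↦ (hu i (mem_univ i)).2⟩

/-- The unit box has Lebesgue measure `1`. [folklore] -/
theorem volume_box : volume (box : Set (ι → ℝ)) = 1 := by
  rw [box, volume_pi_pi]
  simp

/-- **`proj` maps the unit box measure-preservingly onto the torus** (Lebesgue measure on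
`(0, 1]^ι` to the normalised Haar measure): the product of Mathlib's
`UnitAddCircle.measurePreserving_mk`. [folklore] -/
theorem measurePreserving_proj_box :
    MeasurePreserving (proj Φ) ((volume : Measure (ι → ℝ)).restrict box)
      (volume : Measure (ComplexTorus Φ)) := by
  have h := measurePreserving_pi (fun _ : ι ↦ (volume : Measure ℝ).restrict (Ioc (0 : ℝ) (0 + 1)))
    (fun _ : ι ↦ (volume : Measure (AddCircle (1 : ℝ))))
    (f := fun _ (x : ℝ) ↦ ((x : ℝ) : AddCircle (1 : ℝ))) fun _ ↦ UnitAddCircle.measurePreserving_mk 0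
  rw [zero_add] at h
  have hμ : Measure.pi (fun _ : ι ↦ (volume : Measure ℝ).restrict (Ioc (0 : ℝ) 1)) =
      (volume : Measure (ι → ℝ)).restrict box := by
    rw [box, volume_pi, ← Measure.restrict_pi_pi]
  rw [hμ] at h
  exact h

/-- **Integration over the box computes integrals over the torus**:
`∫_{u ∈ (0,1]^ι} g (proj u) du = ∫ₓ g` for continuous `g`. [folklore] -/
theorem setIntegral_box_comp_proj {Y : Type*} [NormedAddCommGroup Y] [NormedSpace ℝ Y]
    {g : ComplexTorus Φ → Y} (hg : Continuous g) :
    ∫ u in box, g (proj Φ u) = ∫ x, g x := by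
  have h := measurePreserving_proj_box Φ
  rw [← integral_map h.measurable.aemeasurable hg.aestronglyMeasurable, h.map_eq]

/-! ### Box averages of periodic lifts -/

section Forms

variable {F : Type*} [NormedAddCommGroup F] [NormedSpace ℝ F] {k : ℕ}

/-- The lift is compatible with subtraction. [folklore] -/
theorem liftForm_sub (α β : MForm 𝓘(ℝ, E) (ComplexTorus Φ) F k) :
    liftForm Φ (α - β) = liftForm Φ α - liftForm Φ β :=
  rfl

/-- **The box average of the translates of a lift is the torus average**:
`∫_{u ∈ (0,1]^ι} α̃ (x + Φ u) du = ∫ₓ α` for every `x` (the translates of the fundamental box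
are fundamental domains; Haar invariance on the torus). [cite: LangeBirkenhake1992, §1.1.4] -/
theorem setIntegral_box_liftForm_add {α : MForm 𝓘(ℝ, E) (ComplexTorus Φ) F k}
    (hα : Continuous (liftForm Φ α)) (x : E) :
    ∫ u in box, liftForm Φ α (x + Φ u) = avg Φ α := by
  have h1 : ∀ u : ι → ℝ, liftForm Φ α (x + Φ u) = val Φ α (proj Φ u + cover Φ x) := by
    intro u
    rw [← val_cover, cover_add, cover_apply_apply, add_comm]
  simp only [h1]
  rw [show (∫ u in box, val Φ α (proj Φ u + cover Φ x)) = ∫ t, val Φ α (t + cover Φ x) from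
    setIntegral_box_comp_proj Φ (g := fun t ↦ val Φ α (t + cover Φ x))
      ((continuous_val Φ hα).comp (continuous_id.add continuous_const))]
  exact integral_val_add_cover Φ α x

variable [FiniteDimensional ℂ E] [CompleteSpace F]

/-- **The averaged homotopy operator**: `η(x) = ∫_{u ∈ (0,1]^ι} P_{Φu} θ (x) du`, a `k`-form on `E`
for a `(k+1)`-form `θ`. [cite: BottTu1982Forms, §I.4] -/
def avgTransOperator (θ : E → E [⋀^Fin (k + 1)]→L[ℝ] F) (x : E) : E [⋀^Fin k]→L[ℝ] F :=
  ∫ u in box, transOperator (Φ u) θ x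

omit [CompleteSpace F] in
/-- The integrand `(u, x) ↦ P_{Φu} θ (x)` is jointly `C^∞`. [folklore] -/
theorem contDiff_transOperator_comp {θ : E → E [⋀^Fin (k + 1)]→L[ℝ] F} (hθ : ContDiff ℝ ∞ θ) :
    ContDiff ℝ ∞ fun p : (ι → ℝ) × E ↦ transOperator (Φ p.1) θ p.2 :=
  (contDiff_transOperator_uncurry hθ).comp (f := fun p : (ι → ℝ) × E ↦ (Φ p.1, p.2))
    (((Φ : (ι → ℝ) →L[ℝ] E).contDiff.comp contDiff_fst).prodMk contDiff_snd)

omit [CompleteSpace F] in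
/-- **The averaged homotopy operator preserves smoothness** (smooth dependence of integrals over
the bounded box on the parameter, `contDiff_parametric_setIntegral`). [folklore] -/
theorem contDiff_avgTransOperator {θ : E → E [⋀^Fin (k + 1)]→L[ℝ] F} (hθ : ContDiff ℝ ∞ θ) :
    ContDiff ℝ ∞ (avgTransOperator Φ θ) :=
  Literature.Analysis.FunctionSpaces.contDiff_parametric_setIntegral (μ := volume)
    isBounded_box measurableSet_box (contDiff_transOperator_comp Φ hθ)

omit [FiniteDimensional ℂ E] [CompleteSpace F] in
/-- The averaged homotopy operator preserves periods. [folklore] -/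
theorem avgTransOperator_add_period {θ : E → E [⋀^Fin (k + 1)]→L[ℝ] F} {l : E}
    (h : ∀ y, θ (y + l) = θ y) (x : E) :
    avgTransOperator Φ θ (x + l) = avgTransOperator Φ θ x := by
  refine setIntegral_congr_fun measurableSet_box fun u _ ↦ ?_
  exact transOperator_add_period (Φ u) h x

set_option synthInstance.maxHeartbeats 200000 in
-- operator-norm instances on the iterated spaces `E →L[ℝ] E [⋀^Fin k]→L[ℝ] F` are slow to find
/-- **The exterior derivative of the averaged homotopy operator of a closed form**:
`d η (x) = ∫_{u ∈ box} θ (x + Φ u) du - θ x` (differentiate under the integral sign, then the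
homotopy formula `d (P_a θ) = θ(· + a) - θ` pointwise in `a = Φ u`, and `vol (box) = 1`).
[cite: BottTu1982Forms, §I.4] -/
theorem extDeriv_avgTransOperator {θ : E → E [⋀^Fin (k + 1)]→L[ℝ] F} (hθ : ContDiff ℝ ∞ θ)
    (hcl : extDeriv θ = 0) (x : E) :
    extDeriv (avgTransOperator Φ θ) x = (∫ u in box, θ (x + Φ u)) - θ x := by
  -- the operator-norm instances on `E →L[ℝ] E [⋀^Fin k]→L[ℝ] F`, found once
  letI iN : NormedAddCommGroup (E →L[ℝ] E [⋀^Fin k]→L[ℝ] F) := inferInstance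
  letI iS : NormedSpace ℝ (E →L[ℝ] E [⋀^Fin k]→L[ℝ] F) := inferInstance
  have hinf : (∞ : WithTop ℕ∞) ≠ 0 := by simp
  set H : (ι → ℝ) × E → E [⋀^Fin k]→L[ℝ] F := fun p ↦ transOperator (Φ p.1) θ p.2 with hHdef
  have hH : ContDiff ℝ ∞ H := contDiff_transOperator_comp Φ hθ
  -- the derivative under the integral sign, as a `CLM`-valued integral
  set D : (ι → ℝ) → E →L[ℝ] E [⋀^Fin k]→L[ℝ] F :=
    fun u ↦ (fderiv ℝ H (u, x)).comp (ContinuousLinearMap.inr ℝ (ι → ℝ) E) with hDdef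
  have hD : HasFDerivAt (avgTransOperator Φ θ) (∫ u in box, D u) x :=
    Literature.Analysis.FunctionSpaces.hasFDerivAt_parametric_setIntegral (μ := volume)
      isBounded_box measurableSet_box hH hinf x
  have hDc : Continuous D :=
    ((ContinuousLinearMap.compL ℝ E ((ι → ℝ) × E) (E [⋀^Fin k]→L[ℝ] F)).flip
      (ContinuousLinearMap.inr ℝ (ι → ℝ) E)).continuous.comp
      ((hH.continuous_fderiv hinf).comp (continuous_id.prodMk continuous_const))
  have hDint : IntegrableOn D box volume :=
    Literature.Analysis.FunctionSpaces.integrableOn_of_continuous_of_isBounded hDc isBounded_box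
  -- pointwise: `Alt (D u) = d (P_{Φu} θ) x = θ (x + Φ u) - θ x`
  have hDu : ∀ u, D u = fderiv ℝ (transOperator (Φ u) θ) x := fun u ↦
    ((Literature.Analysis.FunctionSpaces.hasFDerivAt_comp_prodMk_param hH hinf u x).fderiv).symm
  have hpt : ∀ u, alternatizeUncurryFinCLM ℝ E F (D u) = θ (x + Φ u) - θ x := by
    intro u
    rw [hDu, alternatizeUncurryFinCLM_apply, sub_eq_extDeriv_transOperator (Φ u) hθ hcl x]
    rfl
  -- assemble
  have hθc : Continuous fun u : ι → ℝ ↦ θ (x + Φ u) :=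
    hθ.continuous.comp (continuous_const.add Φ.continuous)
  rw [extDeriv, hD.fderiv, ← alternatizeUncurryFinCLM_apply,
    ← ContinuousLinearMap.integral_comp_comm _ hDint]
  simp only [hpt]
  rw [integral_sub (Literature.Analysis.FunctionSpaces.integrableOn_of_continuous_of_isBounded hθc
      isBounded_box) (integrableOn_const (hs := by rw [volume_box]; exact ENNReal.one_ne_top)),
    setIntegral_const]
  simp [Measure.real, volume_box]

/-- **Every closed smooth form of positive degree on the torus is its average minus an exact
form, with an explicit smooth primitive**: `α = constForm (∫ₓ α) - d β₀`,
`β₀ = descend (∫_u P_{Φu} α̃ du)`. Lange–Birkenhake (1992), §1.1.4 / Prop. 1.1.20.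
[cite: LangeBirkenhake1992, Prop. 1.1.20] -/
theorem eq_constForm_avg_sub_mextDeriv (α : closedSmoothForms 𝓘(ℝ, E) (ComplexTorus Φ) F (k + 1)) :
    IsSmoothForm (descendForm Φ (avgTransOperator Φ (liftForm Φ (α : MForm _ _ F (k + 1))))) ∧
    (α : MForm 𝓘(ℝ, E) (ComplexTorus Φ) F (k + 1)) = constForm Φ (avg Φ (α : MForm _ _ F (k + 1))) -
      mextDeriv (descendForm Φ (avgTransOperator Φ (liftForm Φ (α : MForm _ _ F (k + 1))))) := by
  set θ := liftForm Φ (α : MForm 𝓘(ℝ, E) (ComplexTorus Φ) F (k + 1)) with hθdef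
  have hθ : ContDiff ℝ ∞ θ := (isSmoothForm_iff_contDiff_liftForm Φ _).1 α.2.1
  have hcl : extDeriv θ = 0 := (isClosedForm_iff_extDeriv_liftForm Φ _).1 α.2.2
  set η := avgTransOperator Φ θ with hηdef
  have hηs : ContDiff ℝ ∞ η := contDiff_avgTransOperator Φ hθ
  have hηper : ∀ (z : E) (n : ι → ℤ), η (z + latticeVec Φ n) = η z := fun z n ↦
    avgTransOperator_add_period Φ (fun y ↦ liftForm_add_latticeVec Φ _ y n) z
  have hlift : liftForm Φ (descendForm Φ η) = η := liftForm_descendForm Φ hηper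
  have hsm : IsSmoothForm (descendForm Φ η) := by
    rw [isSmoothForm_iff_contDiff_liftForm, hlift]
    exact hηs
  refine ⟨hsm, liftForm_injective Φ ?_⟩
  rw [liftForm_sub, liftForm_mextDeriv, hlift, liftForm_constForm]
  funext x
  rw [Pi.sub_apply, extDeriv_avgTransOperator Φ hθ hcl x,
    setIntegral_box_liftForm_add Φ hθ.continuous x]
  abel

omit [FiniteDimensional ℂ E] [CompleteSpace F] in
/-- For a `0`-form, `dθ = 0` forces `Dθ = 0` (the alternatisation in degree `0` is injective).
[folklore] -/
theorem fderiv_eq_zero_of_extDeriv_eq_zero {θ : E → E [⋀^Fin 0]→L[ℝ] F} (h : extDeriv θ = 0)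
    (x : E) : fderiv ℝ θ x = 0 := by
  ext v u
  have h1 : extDeriv θ x (Matrix.vecCons v u) = 0 := by rw [h]; rfl
  rw [extDeriv, alternatizeUncurryFin_apply, Fin.sum_univ_succ, Fin.sum_univ_zero, add_zero] at h1
  simp only [Fin.val_zero, pow_zero, one_smul, Matrix.cons_val_zero] at h1
  have hu : (0 : Fin 1).removeNth (Matrix.vecCons v u) = u := Subsingleton.elim _ _
  rw [hu] at h1
  rw [h1]
  rfl

omit [FiniteDimensional ℂ E] in
/-- **A closed smooth `0`-form on the torus is an invariant form** (a constant: `E` is connected).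
[cite: LangeBirkenhake1992, Prop. 1.1.20] -/
theorem eq_constForm_avg_zero (α : closedSmoothForms 𝓘(ℝ, E) (ComplexTorus Φ) F 0) :
    (α : MForm 𝓘(ℝ, E) (ComplexTorus Φ) F 0) = constForm Φ (avg Φ (α : MForm _ _ F 0)) := by
  set θ := liftForm Φ (α : MForm 𝓘(ℝ, E) (ComplexTorus Φ) F 0) with hθdef
  have hθ : ContDiff ℝ ∞ θ := (isSmoothForm_iff_contDiff_liftForm Φ _).1 α.2.1
  have hcl : extDeriv θ = 0 := (isClosedForm_iff_extDeriv_liftForm Φ _).1 α.2.2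
  have hconst : ∀ z, θ z = θ 0 := fun z ↦
    is_const_of_fderiv_eq_zero (hθ.differentiable (by simp))
      (fderiv_eq_zero_of_extDeriv_eq_zero hcl) z 0
  have hαc : (α : MForm 𝓘(ℝ, E) (ComplexTorus Φ) F 0) = constForm Φ (θ 0) :=
    liftForm_injective Φ (funext fun z ↦ by rw [liftForm_constForm]; exact hconst z)
  conv_lhs => rw [hαc]
  rw [hαc, avg_constForm]

/-- **Every de Rham class of the torus has an invariant representative, its average**:
`[α] = [constForm (∫ₓ α)]` for every closed smooth `k`-form `α` (the surjectivity half of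
Lange–Birkenhake (1992), Prop. 1.1.20). [cite: LangeBirkenhake1992, Prop. 1.1.20] -/
theorem mk_eq_constClass_avg (α : closedSmoothForms 𝓘(ℝ, E) (ComplexTorus Φ) F k) :
    deRhamCohomology.mk α = constClass Φ (avg Φ (α : MForm 𝓘(ℝ, E) (ComplexTorus Φ) F k)) := by
  rw [constClass_apply, deRhamCohomology.mk_eq_mk_iff]
  cases k with
  | zero =>
    change (α : MForm 𝓘(ℝ, E) (ComplexTorus Φ) F 0) - constForm Φ (avg Φ (α : MForm _ _ F 0)) ∈ _
    rw [← eq_constForm_avg_zero Φ α, sub_self]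
    exact Submodule.zero_mem _
  | succ k =>
    obtain ⟨hsm, heq⟩ := eq_constForm_avg_sub_mextDeriv Φ α
    change (α : MForm 𝓘(ℝ, E) (ComplexTorus Φ) F (k + 1)) -
      constForm Φ (avg Φ (α : MForm _ _ F (k + 1))) ∈ _
    have h2 := (congrArg (fun t ↦ t - constForm Φ (avg Φ (α : MForm _ _ F (k + 1)))) heq).trans
      (sub_sub_cancel_left _ _)
    rw [h2]
    exact Submodule.neg_mem _ (Submodule.subset_span ⟨_, hsm, rfl⟩)

/-- `constClass ∘ avgClass = id` on de Rham cohomology. [cite: LangeBirkenhake1992, Prop. 1.1.20] -/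
@[simp] theorem constClass_avgClass (c : deRhamCohomology 𝓘(ℝ, E) (ComplexTorus Φ) F k) :
    constClass Φ (avgClass Φ c) = c := by
  obtain ⟨α, rfl⟩ := deRhamCohomology.mk_surjective c
  rw [avgClass_mk]
  exact (mk_eq_constClass_avg Φ α).symm

/-- **Lange–Birkenhake (1992), Prop. 1.1.20: the de Rham cohomology of a complex torus is the
space of invariant forms**, `Alt^k(E; F) ≃ₗ[ℝ] H^k_dR(E/Φ(ℤ^ι); F)`, `c ↦ [constForm Φ c]`, with
inverse the average `avgClass` ("the de Rham isomorphism induces an isomorphism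
`H^n_dR(X) ≃ IF^n(X)`"; here for any complete real coefficient space `F`, e.g. `ℝ`, `ℂ`).
[cite: LangeBirkenhake1992, Prop. 1.1.20] -/
def constClassEquiv : (E [⋀^Fin k]→L[ℝ] F) ≃ₗ[ℝ] deRhamCohomology 𝓘(ℝ, E) (ComplexTorus Φ) F k :=
  LinearEquiv.ofLinear (constClass Φ) (avgClass Φ) (LinearMap.ext (constClass_avgClass Φ))
    (LinearMap.ext (avgClass_constClass Φ))

/-- `constClassEquiv` is `constClass`. [folklore] -/
@[simp] theorem constClassEquiv_apply (c : E [⋀^Fin k]→L[ℝ] F) :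
    constClassEquiv Φ c = constClass Φ (F := F) (k := k) c :=
  rfl

/-- The inverse of `constClassEquiv` is the average. [folklore] -/
@[simp] theorem constClassEquiv_symm_apply (c : deRhamCohomology 𝓘(ℝ, E) (ComplexTorus Φ) F k) :
    (constClassEquiv Φ).symm c = avgClass Φ c :=
  rfl

/-- `constClass` is a bijection onto de Rham cohomology. [cite: LangeBirkenhake1992, Prop. 1.1.20] -/
theorem constClass_bijective :
    Function.Bijective (constClass Φ : (E [⋀^Fin k]→L[ℝ] F) → deRhamCohomology 𝓘(ℝ, E) (ComplexTorus Φ) F k) :=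
  (constClassEquiv Φ).bijective

end Forms

end ComplexTorus

end Literature.Geometry.Kaehler
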